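/-
Copyright (c) 2026 the pub-hodgecm-mathlib formalisation cell (harness21).  Prover seat hodgecm-mathlib-K2E4-p01 (g2), Track B ∕ K2-LIT (build stream 29),
h413 = `stmt-HodgeConjecture-24833`, line `K2_E4_SingularTransferKappaSign`, socket module «SplitDescent» (U5), socket #1′ (the un-pinned twin) BY NAME.  2026-09-04.
-/
import Summits.HodgeConjecture.HodgeConjecture.Theorems.K2E4ExplicitSplitSingularTransferOfGermSockets      -- ★ p854823 (g0): §1 linear algebra `exists_ne_zero_forall_eq_mul_of_kernel_subset`, …; the frame
import Summits.HodgeConjecture.HodgeConjecture.Theorems.K2E3GermConstantStableSheetsUSplitOfDensity       -- ★ U2 (this seat): #5U∣split ⟸ (B_v)[Δ‴_v]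
import Summits.HodgeConjecture.HodgeConjecture.Theorems.K2E3CentralTransferVanishingSplitExplicit        -- ★ U3 (this seat): (B_v)[Δ‴_v] ⟸ T0 ∘ (HC₁^P)
import Summits.HodgeConjecture.HodgeConjecture.Theorems.K2E3GermConstantRegularHUSplit                   -- ★ U1 (this seat): #7U∣split
import HarnessLib

/-!
# h413 ∕ Track B «K2-LIT», line `K2_E4_SingularTransferKappaSign`, socket «SplitDescent» #1′ BY NAME:
# `sig_K2E4ExplicitSplitSingularTransferU` — the singular `κ`-transfer at SPLIT places for the EXPLICIT factor against a WEAK frame [Rogawski1990, Prop. 8.2.1 (a)]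

Cell `pub/hodgecm-mathlib`, crux H413 = `stmt-HodgeConjecture-24833`, route `HCCMUnconditional`; chair K2-lead (g0), dealer K2E4-plan (g0) (SplitDescent ED. 4: sole hole = #1′;
tier 0: stub C ⟸ {#1′, #22S}); seat K2E4-p01 (g2) (TAKING 00:0xZ).  THEOREMS ONLY (no `def`, no `instance`, no `notation`, no named-fact hypothesis, no `sorry`, default heartbeats).

STATEMENT = the bytes of `Summit.HodgeConjecture.HodgeConjecture.Cruxes.H413.K2E4SingularTransferKappaSign.SplitDescent.sig_K2E4ExplicitSplitSingularTransferU`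
(`Cruxes/H413/Lines/K2_E4_SingularTransferKappaSignSigsSplitDescent.lean` :185–:243) VERBATIM: the UN-PINNED twin of #1 (chair RULING R10 (i)) — no `hΔ`∕`hTinf`, transfer relation
for the term `finExplicitCollection L H′ μ … v` against the weak frame's canonical `(mH v, mG v)`.  (#1 itself is ★ p855710; #1 ⟸ #1′ is ★ p854991.)

PROOF = g0's ★ p854823 linear algebra (`exists_ne_zero_forall_eq_mul_of_kernel_subset`; closure of explicit-factor pairs under `(p, q, a) ↦ p − a q` by ★ `IsLocalDeltaTransfer.add`∕`.smul_fun`,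
which are factor-agnostic; linearity of `Φ^st_{|ω|}((γ₀)_v, ·)`) fed with
* kernel inclusion = ★ U2 `GermConstantStableSheetsU_split_of_centralDensity` ∘ ★ U3 `centralTransferVanishing_split_explicit` (∘ ★ p855516 T0 ∘ ★ p855560 (HC₁^P): Harish-Chandra density
  at the centre of `GL₂ × GL₁`, one ramified torus, two depths);
* witness = ★ U1 `germConstantRegularHU_of_not_subsingleton` (K2E4-p07's named split transfer, hΔ-free).
HONEST LABEL.  HC_CM is proved only modulo the 7 printed citations (2 remaining named inputs: hLiu418 = `stmt-HodgeConjecture-24832`, h413 = `stmt-HodgeConjecture-24833`)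
until rung 0 closes; this file pays socket #1′ of the K2E4 skeleton and moves no crux counter by itself.

## References
* [Rogawski1990] J. D. Rogawski, *Automorphic Representations of Unitary Groups in Three Variables*, Ann. of Math. Stud. 123 (1990): §8.2 Prop. 8.2.1 (a) pp. 117–118;
  §4.13 Lemma 4.13.1 (a) p. 70; §8.1 p. 116; §4.3 (4.3.1) p. 43.
* [HarishChandra1999AdmissibleDistributions] Harish-Chandra (DeBacker–Sally), *Admissible Invariant Distributions on Reductive p-adic Groups*, AMS ULS 16 (1999), Thm. 3.1.
* [LabesseLanglands1979] J.-P. Labesse, R. P. Langlands, *L-indistinguishability for SL(2)*, Canad. J. Math. 31 (1979), §2 pp. 7–9.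
-/

set_option autoImplicit false
set_option linter.dupNamespace false

noncomputable section

open MeasureTheory Measure NumberField IsDedekindDomain
open Literature.MeasureTheory.Group Literature.MeasureTheory.RestrictedProduct
open Literature.Topology.RestrictedProduct Literature.Topology.Algebra.RestrictedProduct
open Literature.NumberTheory.Rogawski1990 Literature.NumberTheory.Automorphic
open Literature.AlgebraicGeometry.ShimuraVarieties (unitaryGroup hermForm)
open scoped Matrix MatrixGroups RestrictedProduct
open Summit.HodgeConjecture.HodgeConjecture.Cruxes.H413
open Summit.HodgeConjecture.HodgeConjecture.Cruxes.H413.K2E4ExplicitSplitSingularTransferOfGermSockets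

namespace Summit.HodgeConjecture.HodgeConjecture.Cruxes.H413.K2E4ExplicitSplitSingularTransferU

section Frame
variable (L : Type) [Field L] [NumberField L] [IsCMField L]

variable (H' : Matrix (Fin 3) (Fin 3) L) (Tinf : ArchTransferFactor L H')
    -- σ-algebras of the `G′` side (★ (O10-c5) block), of `H_v`, `G_∞`, `H_∞`, and the Haar data — EXACTLY ★ `SingularEllipticTransfer`'s binders
    [∀ g : (UnitaryGroup.cmDatum L 3 H').Adelic, MeasurableSpace ((UnitaryGroup.cmDatum L 3 H').Adelic ⧸ Subgroup.centralizer ({g} : Set (UnitaryGroup.cmDatum L 3 H').Adelic))]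
    [∀ g : (UnitaryGroup.cmDatum L 3 H').Adelic, BorelSpace ((UnitaryGroup.cmDatum L 3 H').Adelic ⧸ Subgroup.centralizer ({g} : Set (UnitaryGroup.cmDatum L 3 H').Adelic))]
    [∀ γ : UnitaryGroup.arch (↥(maximalRealSubfield L)) L (IsCMField.complexConj L) 3 H',
      MeasurableSpace (UnitaryGroup.arch (↥(maximalRealSubfield L)) L (IsCMField.complexConj L) 3 H' ⧸ Subgroup.centralizer ({γ} : Set (UnitaryGroup.arch (↥(maximalRealSubfield L)) L (IsCMField.complexConj L) 3 H')))]
    [∀ γ : UnitaryGroup.arch (↥(maximalRealSubfield L)) L (IsCMField.complexConj L) 3 H',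
      BorelSpace (UnitaryGroup.arch (↥(maximalRealSubfield L)) L (IsCMField.complexConj L) 3 H' ⧸ Subgroup.centralizer ({γ} : Set (UnitaryGroup.arch (↥(maximalRealSubfield L)) L (IsCMField.complexConj L) 3 H')))]
    [∀ (v : HeightOneSpectrum (𝓞 ↥(maximalRealSubfield L))) (γ : (UnitaryGroup.cmDatum L 3 H').Local v),
      MeasurableSpace ((UnitaryGroup.cmDatum L 3 H').Local v ⧸ Subgroup.centralizer ({γ} : Set ((UnitaryGroup.cmDatum L 3 H').Local v)))]
    [∀ (v : HeightOneSpectrum (𝓞 ↥(maximalRealSubfield L))) (γ : (UnitaryGroup.cmDatum L 3 H').Local v),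
      BorelSpace ((UnitaryGroup.cmDatum L 3 H').Local v ⧸ Subgroup.centralizer ({γ} : Set ((UnitaryGroup.cmDatum L 3 H').Local v)))]
    [∀ v : HeightOneSpectrum (𝓞 ↥(maximalRealSubfield L)), MeasurableSpace ((UnitaryGroup.cmDatum L 3 H').Local v)] [∀ v : HeightOneSpectrum (𝓞 ↥(maximalRealSubfield L)), BorelSpace ((UnitaryGroup.cmDatum L 3 H').Local v)]
    [MeasurableSpace (UnitaryGroup.cmDatum L 3 H').Adelic] [BorelSpace (UnitaryGroup.cmDatum L 3 H').Adelic]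
    [MeasurableSpace (UnitaryGroup.arch (↥(maximalRealSubfield L)) L (IsCMField.complexConj L) 3 H')] [BorelSpace (UnitaryGroup.arch (↥(maximalRealSubfield L)) L (IsCMField.complexConj L) 3 H')]
    [∀ γ : (UnitaryGroup.cmDatum L 3 H').Adelic, MeasurableSpace (↥(Subgroup.centralizer ({γ} : Set (UnitaryGroup.cmDatum L 3 H').Adelic)) ⧸
      ((UnitaryGroup.cmDatum L 3 H').quotientSubgroup ⊓ Subgroup.centralizer ({γ} : Set (UnitaryGroup.cmDatum L 3 H').Adelic)).subgroupOf (Subgroup.centralizer ({γ} : Set (UnitaryGroup.cmDatum L 3 H').Adelic)))]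
    [∀ γ : (UnitaryGroup.cmDatum L 3 H').Adelic, BorelSpace (↥(Subgroup.centralizer ({γ} : Set (UnitaryGroup.cmDatum L 3 H').Adelic)) ⧸
      ((UnitaryGroup.cmDatum L 3 H').quotientSubgroup ⊓ Subgroup.centralizer ({γ} : Set (UnitaryGroup.cmDatum L 3 H').Adelic)).subgroupOf (Subgroup.centralizer ({γ} : Set (UnitaryGroup.cmDatum L 3 H').Adelic)))]
    [hCcl : ∀ γ : (UnitaryGroup.cmDatum L 3 H').Adelic, IsClosed ((Subgroup.centralizer ({γ} : Set (UnitaryGroup.cmDatum L 3 H').Adelic) : Subgroup (UnitaryGroup.cmDatum L 3 H').Adelic) : Set (UnitaryGroup.cmDatum L 3 H').Adelic)]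
    [∀ γ : (UnitaryGroup.cmDatum L 3 H').Adelic, (count : Measure ↥(((UnitaryGroup.cmDatum L 3 H').quotientSubgroup ⊓ Subgroup.centralizer ({γ} : Set (UnitaryGroup.cmDatum L 3 H').Adelic)).subgroupOf
      (Subgroup.centralizer ({γ} : Set (UnitaryGroup.cmDatum L 3 H').Adelic)))).IsHaarMeasure]
    [∀ v : HeightOneSpectrum (𝓞 ↥(maximalRealSubfield L)), MeasurableSpace ((UnitaryGroup.cmDatum L 2 (Matrix.of fun i j : Fin 2 => if i.val + j.val + 1 = 2 then (1 : L) else 0)).Local v ×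
        (UnitaryGroup.cmDatum L 1 (Matrix.of fun i j : Fin 1 => if i.val + j.val + 1 = 1 then (1 : L) else 0)).Local v)]
    [∀ v : HeightOneSpectrum (𝓞 ↥(maximalRealSubfield L)), BorelSpace ((UnitaryGroup.cmDatum L 2 (Matrix.of fun i j : Fin 2 => if i.val + j.val + 1 = 2 then (1 : L) else 0)).Local v ×
        (UnitaryGroup.cmDatum L 1 (Matrix.of fun i j : Fin 1 => if i.val + j.val + 1 = 1 then (1 : L) else 0)).Local v)]
    [∀ (v : HeightOneSpectrum (𝓞 ↥(maximalRealSubfield L))) (a : ((UnitaryGroup.cmDatum L 2 (Matrix.of fun i j : Fin 2 => if i.val + j.val + 1 = 2 then (1 : L) else 0)).Local v ×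
        (UnitaryGroup.cmDatum L 1 (Matrix.of fun i j : Fin 1 => if i.val + j.val + 1 = 1 then (1 : L) else 0)).Local v)),
      MeasurableSpace (((UnitaryGroup.cmDatum L 2 (Matrix.of fun i j : Fin 2 => if i.val + j.val + 1 = 2 then (1 : L) else 0)).Local v ×
        (UnitaryGroup.cmDatum L 1 (Matrix.of fun i j : Fin 1 => if i.val + j.val + 1 = 1 then (1 : L) else 0)).Local v) ⧸ Subgroup.centralizer ({a} : Set ((UnitaryGroup.cmDatum L 2 (Matrix.of fun i j : Fin 2 => if i.val + j.val + 1 = 2 then (1 : L) else 0)).Local v ×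
        (UnitaryGroup.cmDatum L 1 (Matrix.of fun i j : Fin 1 => if i.val + j.val + 1 = 1 then (1 : L) else 0)).Local v)))]
    [∀ (v : HeightOneSpectrum (𝓞 ↥(maximalRealSubfield L))) (a : ((UnitaryGroup.cmDatum L 2 (Matrix.of fun i j : Fin 2 => if i.val + j.val + 1 = 2 then (1 : L) else 0)).Local v ×
        (UnitaryGroup.cmDatum L 1 (Matrix.of fun i j : Fin 1 => if i.val + j.val + 1 = 1 then (1 : L) else 0)).Local v)),
      BorelSpace (((UnitaryGroup.cmDatum L 2 (Matrix.of fun i j : Fin 2 => if i.val + j.val + 1 = 2 then (1 : L) else 0)).Local v ×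
        (UnitaryGroup.cmDatum L 1 (Matrix.of fun i j : Fin 1 => if i.val + j.val + 1 = 1 then (1 : L) else 0)).Local v) ⧸ Subgroup.centralizer ({a} : Set ((UnitaryGroup.cmDatum L 2 (Matrix.of fun i j : Fin 2 => if i.val + j.val + 1 = 2 then (1 : L) else 0)).Local v ×
        (UnitaryGroup.cmDatum L 1 (Matrix.of fun i j : Fin 1 => if i.val + j.val + 1 = 1 then (1 : L) else 0)).Local v)))]
    [MeasurableSpace (UnitaryGroup.arch (↥(maximalRealSubfield L)) L (IsCMField.complexConj L) 3 (Matrix.of fun i j : Fin 3 => if i.val + j.val + 1 = 3 then (1 : L) else 0))] [BorelSpace (UnitaryGroup.arch (↥(maximalRealSubfield L)) L (IsCMField.complexConj L) 3 (Matrix.of fun i j : Fin 3 => if i.val + j.val + 1 = 3 then (1 : L) else 0))]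
    [∀ γ : UnitaryGroup.arch (↥(maximalRealSubfield L)) L (IsCMField.complexConj L) 3 (Matrix.of fun i j : Fin 3 => if i.val + j.val + 1 = 3 then (1 : L) else 0),
      MeasurableSpace (UnitaryGroup.arch (↥(maximalRealSubfield L)) L (IsCMField.complexConj L) 3 (Matrix.of fun i j : Fin 3 => if i.val + j.val + 1 = 3 then (1 : L) else 0) ⧸ Subgroup.centralizer ({γ} : Set (UnitaryGroup.arch (↥(maximalRealSubfield L)) L (IsCMField.complexConj L) 3 (Matrix.of fun i j : Fin 3 => if i.val + j.val + 1 = 3 then (1 : L) else 0))))]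
    [∀ γ : UnitaryGroup.arch (↥(maximalRealSubfield L)) L (IsCMField.complexConj L) 3 (Matrix.of fun i j : Fin 3 => if i.val + j.val + 1 = 3 then (1 : L) else 0),
      BorelSpace (UnitaryGroup.arch (↥(maximalRealSubfield L)) L (IsCMField.complexConj L) 3 (Matrix.of fun i j : Fin 3 => if i.val + j.val + 1 = 3 then (1 : L) else 0) ⧸ Subgroup.centralizer ({γ} : Set (UnitaryGroup.arch (↥(maximalRealSubfield L)) L (IsCMField.complexConj L) 3 (Matrix.of fun i j : Fin 3 => if i.val + j.val + 1 = 3 then (1 : L) else 0))))]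
    [MeasurableSpace (UnitaryGroup.arch (↥(maximalRealSubfield L)) L (IsCMField.complexConj L) 2 (Matrix.of fun i j : Fin 2 => if i.val + j.val + 1 = 2 then (1 : L) else 0) ×
          UnitaryGroup.arch (↥(maximalRealSubfield L)) L (IsCMField.complexConj L) 1 (Matrix.of fun i j : Fin 1 => if i.val + j.val + 1 = 1 then (1 : L) else 0))]
    [BorelSpace (UnitaryGroup.arch (↥(maximalRealSubfield L)) L (IsCMField.complexConj L) 2 (Matrix.of fun i j : Fin 2 => if i.val + j.val + 1 = 2 then (1 : L) else 0) ×
          UnitaryGroup.arch (↥(maximalRealSubfield L)) L (IsCMField.complexConj L) 1 (Matrix.of fun i j : Fin 1 => if i.val + j.val + 1 = 1 then (1 : L) else 0))]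
    [∀ a : (UnitaryGroup.arch (↥(maximalRealSubfield L)) L (IsCMField.complexConj L) 2 (Matrix.of fun i j : Fin 2 => if i.val + j.val + 1 = 2 then (1 : L) else 0) ×
          UnitaryGroup.arch (↥(maximalRealSubfield L)) L (IsCMField.complexConj L) 1 (Matrix.of fun i j : Fin 1 => if i.val + j.val + 1 = 1 then (1 : L) else 0)),
      MeasurableSpace ((UnitaryGroup.arch (↥(maximalRealSubfield L)) L (IsCMField.complexConj L) 2 (Matrix.of fun i j : Fin 2 => if i.val + j.val + 1 = 2 then (1 : L) else 0) ×
          UnitaryGroup.arch (↥(maximalRealSubfield L)) L (IsCMField.complexConj L) 1 (Matrix.of fun i j : Fin 1 => if i.val + j.val + 1 = 1 then (1 : L) else 0)) ⧸ Subgroup.centralizer ({a} : Set (UnitaryGroup.arch (↥(maximalRealSubfield L)) L (IsCMField.complexConj L) 2 (Matrix.of fun i j : Fin 2 => if i.val + j.val + 1 = 2 then (1 : L) else 0) ×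
          UnitaryGroup.arch (↥(maximalRealSubfield L)) L (IsCMField.complexConj L) 1 (Matrix.of fun i j : Fin 1 => if i.val + j.val + 1 = 1 then (1 : L) else 0))))]
    [∀ a : (UnitaryGroup.arch (↥(maximalRealSubfield L)) L (IsCMField.complexConj L) 2 (Matrix.of fun i j : Fin 2 => if i.val + j.val + 1 = 2 then (1 : L) else 0) ×
          UnitaryGroup.arch (↥(maximalRealSubfield L)) L (IsCMField.complexConj L) 1 (Matrix.of fun i j : Fin 1 => if i.val + j.val + 1 = 1 then (1 : L) else 0)),
      BorelSpace ((UnitaryGroup.arch (↥(maximalRealSubfield L)) L (IsCMField.complexConj L) 2 (Matrix.of fun i j : Fin 2 => if i.val + j.val + 1 = 2 then (1 : L) else 0) ×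
          UnitaryGroup.arch (↥(maximalRealSubfield L)) L (IsCMField.complexConj L) 1 (Matrix.of fun i j : Fin 1 => if i.val + j.val + 1 = 1 then (1 : L) else 0)) ⧸ Subgroup.centralizer ({a} : Set (UnitaryGroup.arch (↥(maximalRealSubfield L)) L (IsCMField.complexConj L) 2 (Matrix.of fun i j : Fin 2 => if i.val + j.val + 1 = 2 then (1 : L) else 0) ×
          UnitaryGroup.arch (↥(maximalRealSubfield L)) L (IsCMField.complexConj L) 1 (Matrix.of fun i j : Fin 1 => if i.val + j.val + 1 = 1 then (1 : L) else 0))))]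
    (νH : ∀ v : HeightOneSpectrum (𝓞 ↥(maximalRealSubfield L)), Measure ((UnitaryGroup.cmDatum L 2 (Matrix.of fun i j : Fin 2 => if i.val + j.val + 1 = 2 then (1 : L) else 0)).Local v ×
        (UnitaryGroup.cmDatum L 1 (Matrix.of fun i j : Fin 1 => if i.val + j.val + 1 = 1 then (1 : L) else 0)).Local v))
    (νG : ∀ v : HeightOneSpectrum (𝓞 ↥(maximalRealSubfield L)), Measure ((UnitaryGroup.cmDatum L 3 H').Local v))
    [∀ v, IsFiniteMeasureOnCompacts (νH v)] [∀ v, (νH v).IsMulRightInvariant]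
    [∀ v, (νG v).IsHaarMeasure] [∀ v, (νG v).IsMulRightInvariant]  -- MAIN-b's strength (F2): `νG_v` Haar
    (νGi : Measure (UnitaryGroup.arch (↥(maximalRealSubfield L)) L (IsCMField.complexConj L) 3 H')) (νqi : Measure (UnitaryGroup.arch (↥(maximalRealSubfield L)) L (IsCMField.complexConj L) 3 (Matrix.of fun i j : Fin 3 => if i.val + j.val + 1 = 3 then (1 : L) else 0)))
    (νHi : Measure (UnitaryGroup.arch (↥(maximalRealSubfield L)) L (IsCMField.complexConj L) 2 (Matrix.of fun i j : Fin 2 => if i.val + j.val + 1 = 2 then (1 : L) else 0) ×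
          UnitaryGroup.arch (↥(maximalRealSubfield L)) L (IsCMField.complexConj L) 1 (Matrix.of fun i j : Fin 1 => if i.val + j.val + 1 = 1 then (1 : L) else 0)))
    [IsFiniteMeasureOnCompacts νGi] [νGi.IsMulRightInvariant] [IsFiniteMeasureOnCompacts νqi] [νqi.IsMulRightInvariant]
    [IsFiniteMeasureOnCompacts νHi] [νHi.IsMulRightInvariant]

-- three of the frame's measure-theoretic instance binders and several value binders are auto-bound in the pasted types (bytes frozen) but not read by the deduction
set_option linter.unusedSectionVars false in
/-- **Socket #1′ `sig_K2E4ExplicitSplitSingularTransferU` BY NAME** (bytes of `…SigsSplitDescent.lean` :185–:243 verbatim): for an ARBITRARY weak frame `(Tinf, Δ; hCTM, hACS)` and the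
pinned character `μ`, at every place `v` split in `L`, ONE `c_v ≠ 0` with `Φ^st_{|ω|}(γ_{0,v}, f) = c_v · f^H(γ_{H,v})` for all smooth transfer pairs `(f^H, f)` FOR THE EXPLICIT FACTOR
`Δ‴_v(μ)` against `(mH v, mG v)`. [cite: Rogawski1990, §8.2 Prop. 8.2.1 (a) p. 117; §4.13 Lemma 4.13.1 (a) p. 70] [cite: HarishChandra1999AdmissibleDistributions, Thm. 3.1] -/
theorem explicitSplitSingularTransferU :
        ∀ (hK : ∀ v : HeightOneSpectrum (𝓞 ↥(maximalRealSubfield L)), νG v (UnitaryGroup.cmLocalIntegralLevel L 3 H' v : Set ((UnitaryGroup.cmDatum L 3 H').Local v)) = 1)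
          (hanis : ∀ x : Fin 3 → L, hermForm (cmConjRingHom L) H' x x = 0 → x = 0)
          (Sbad : Finset (HeightOneSpectrum (𝓞 ↥(maximalRealSubfield L))))
              (Δ : ∀ v : HeightOneSpectrum (𝓞 ↥(maximalRealSubfield L)), LocalTransferFactor L H' v)
              (mH : ∀ v : HeightOneSpectrum (𝓞 ↥(maximalRealSubfield L)),
                OrbitalMeasureFamily ((UnitaryGroup.cmDatum L 2 (Matrix.of fun i j : Fin 2 => if i.val + j.val + 1 = 2 then (1 : L) else 0)).Local v ×
                  (UnitaryGroup.cmDatum L 1 (Matrix.of fun i j : Fin 1 => if i.val + j.val + 1 = 1 then (1 : L) else 0)).Local v))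
              (mG : ∀ v : HeightOneSpectrum (𝓞 ↥(maximalRealSubfield L)), OrbitalMeasureFamily ((UnitaryGroup.cmDatum L 3 H').Local v))
          (m' : OrbitalMeasureFamily (UnitaryGroup.arch (↥(maximalRealSubfield L)) L (IsCMField.complexConj L) 3 H'))
                (m : OrbitalMeasureFamily (UnitaryGroup.arch (↥(maximalRealSubfield L)) L (IsCMField.complexConj L) 3
                  (Matrix.of fun i j : Fin 3 => if i.val + j.val + 1 = 3 then (1 : L) else 0)))
                (mHi : OrbitalMeasureFamily (UnitaryGroup.arch (↥(maximalRealSubfield L)) L (IsCMField.complexConj L) 2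
                    (Matrix.of fun i j : Fin 2 => if i.val + j.val + 1 = 2 then (1 : L) else 0) ×
                  UnitaryGroup.arch (↥(maximalRealSubfield L)) L (IsCMField.complexConj L) 1
                    (Matrix.of fun i j : Fin 1 => if i.val + j.val + 1 = 1 then (1 : L) else 0)))
                (t' : ∀ γ' : UnitaryGroup.arch (↥(maximalRealSubfield L)) L (IsCMField.complexConj L) 3 H',
                  Measure (Subgroup.centralizer ({γ'} : Set (UnitaryGroup.arch (↥(maximalRealSubfield L)) L (IsCMField.complexConj L) 3 H'))))
                (t : ∀ γ : UnitaryGroup.arch (↥(maximalRealSubfield L)) L (IsCMField.complexConj L) 3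
                    (Matrix.of fun i j : Fin 3 => if i.val + j.val + 1 = 3 then (1 : L) else 0),
                  Measure (Subgroup.centralizer ({γ} : Set (UnitaryGroup.arch (↥(maximalRealSubfield L)) L (IsCMField.complexConj L) 3
                    (Matrix.of fun i j : Fin 3 => if i.val + j.val + 1 = 3 then (1 : L) else 0)))))
                (tH : ∀ γH : UnitaryGroup.arch (↥(maximalRealSubfield L)) L (IsCMField.complexConj L) 2
                      (Matrix.of fun i j : Fin 2 => if i.val + j.val + 1 = 2 then (1 : L) else 0) ×
                    UnitaryGroup.arch (↥(maximalRealSubfield L)) L (IsCMField.complexConj L) 1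
                      (Matrix.of fun i j : Fin 1 => if i.val + j.val + 1 = 1 then (1 : L) else 0),
                  Measure (Subgroup.centralizer ({γH} : Set (UnitaryGroup.arch (↥(maximalRealSubfield L)) L (IsCMField.complexConj L) 2
                      (Matrix.of fun i j : Fin 2 => if i.val + j.val + 1 = 2 then (1 : L) else 0) ×
                    UnitaryGroup.arch (↥(maximalRealSubfield L)) L (IsCMField.complexConj L) 1
                      (Matrix.of fun i j : Fin 1 => if i.val + j.val + 1 = 1 then (1 : L) else 0)))))
            (hherm : (H'.map (cmConjRingHom L)).transpose = H')
            (hCTM : CanonicalTransferMatrix L H' Tinf.Δ νH νG Sbad Δ mH mG)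
            (hACS : ArchCanonicalSingularMatrix L H' Tinf νGi νqi νHi hanis m' m mHi t' t tH),
    ∀ (μ : Literature.NumberTheory.GaloisRepresentations.HeckeCharacter L) (hμu : μ.IsUnitary)
      (hμω : ∀ x : Literature.NumberTheory.GaloisRepresentations.ideleGroup ↥(maximalRealSubfield L),
        μ (AdeleRing.ideleBaseChange (↥(maximalRealSubfield L)) L x) = quadraticHeckeCharCM L x),
        ∀ (mGs₀ : ∀ v : HeightOneSpectrum (𝓞 ↥(maximalRealSubfield L)), OrbitalMeasureFamily ((UnitaryGroup.cmDatum L 3 H').Local v)),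
          (∀ v, (mGs₀ v).IsQuotientOf (fun x : (UnitaryGroup.cmDatum L 3 H').Local v => ∃ γ₀ : (UnitaryGroup.cmDatum L 3 H').Rational, ¬ IsRegularElt (γ₀.val : GL (Fin 3) L) ∧
                Corresponds (UnitaryGroup.conjLocal L (IsCMField.complexConj L) v)
                  ((UnitaryGroup.adelicForm L 3 H').map (UnitaryGroup.adeleToLocal L v))
                  ((UnitaryGroup.adelicForm L 3 H').map (UnitaryGroup.adeleToLocal L v))
                  ((UnitaryGroup.cmDatum L 3 H').toLocal v ((UnitaryGroup.cmDatum L 3 H').toAdelic γ₀)) x) (νG v) (Literature.NumberTheory.Weil1982.UnitaryFinTopForm.finTamagawaPartner L 3 H' v)) →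
              ∀ (γ₀ : (UnitaryGroup.cmDatum L 3 H').Rational) (e₁ e₂ : L), e₁ ≠ e₂ →
                ((((γ₀ : unitaryGroup (cmConjRingHom L) H').val : GL (Fin 3) L) : Matrix (Fin 3) (Fin 3) L) - e₁ • (1 : Matrix (Fin 3) (Fin 3) L)) * ((((γ₀ : unitaryGroup (cmConjRingHom L) H').val : GL (Fin 3) L) : Matrix (Fin 3) (Fin 3) L) - e₂ • (1 : Matrix (Fin 3) (Fin 3) L)) = 0 →
                (¬ ∃ ζ : L, (((γ₀ : unitaryGroup (cmConjRingHom L) H').val : GL (Fin 3) L) : Matrix (Fin 3) (Fin 3) L) = ζ • (1 : Matrix (Fin 3) (Fin 3) L)) →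
                (((γ₀ : unitaryGroup (cmConjRingHom L) H').val : GL (Fin 3) L) : Matrix (Fin 3) (Fin 3) L).charpoly =
                  (Polynomial.X - Polynomial.C e₁) ^ 2 * (Polynomial.X - Polynomial.C e₂) →
                ∀ (γH : (UnitaryGroup.cmDatum L 2 (Matrix.of fun i j : Fin 2 => if i.val + j.val + 1 = 2 then (1 : L) else 0)).Rational ×
                    (UnitaryGroup.cmDatum L 1 (Matrix.of fun i j : Fin 1 => if i.val + j.val + 1 = 1 then (1 : L) else 0)).Rational),
                  (((γH.1 : unitaryGroup (cmConjRingHom L) (Matrix.of fun i j : Fin 2 => if i.val + j.val + 1 = 2 then (1 : L) else 0)).val : GL (Fin 2) L) : Matrix (Fin 2) (Fin 2) L) =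
                    e₁ • (1 : Matrix (Fin 2) (Fin 2) L) →
                  (((γH.2 : unitaryGroup (cmConjRingHom L) (Matrix.of fun i j : Fin 1 => if i.val + j.val + 1 = 1 then (1 : L) else 0)).val : GL (Fin 1) L) : Matrix (Fin 1) (Fin 1) L) 0 0 = e₂ →
                  ∀ (v : HeightOneSpectrum (𝓞 ↥(maximalRealSubfield L))), ¬ Subsingleton (UnitaryGroup.PlacesOver L v) →
                    ∃ cv : ℂ, cv ≠ 0 ∧ ∀
                          (fH : (UnitaryGroup.cmDatum L 2 (Matrix.of fun i j : Fin 2 => if i.val + j.val + 1 = 2 then (1 : L) else 0)).Local v × (UnitaryGroup.cmDatum L 1 (Matrix.of fun i j : Fin 1 => if i.val + j.val + 1 = 1 then (1 : L) else 0)).Local v → ℂ) (f : (UnitaryGroup.cmDatum L 3 H').Local v → ℂ),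
                        IsLocSmooth f → IsLocSmooth fH → IsLocalDeltaTransfer L H' v (finExplicitCollection L H' μ (finExplicitDelta_conj_left_all L H' μ) (finExplicitDelta_conj_right_all L H' μ) v) (mH v) (mG v) fH f →
                        localStableOrbitalIntegral L 3 H' v (mGs₀ v) f ((UnitaryGroup.cmDatum L 3 H').toLocal v ((UnitaryGroup.cmDatum L 3 H').toAdelic γ₀)) =
                          cv * fH ((UnitaryGroup.cmDatum L 2 (Matrix.of fun i j : Fin 2 => if i.val + j.val + 1 = 2 then (1 : L) else 0)).toLocal v ((UnitaryGroup.cmDatum L 2 (Matrix.of fun i j : Fin 2 => if i.val + j.val + 1 = 2 then (1 : L) else 0)).toAdelic γH.1),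
                            (UnitaryGroup.cmDatum L 1 (Matrix.of fun i j : Fin 1 => if i.val + j.val + 1 = 1 then (1 : L) else 0)).toLocal v ((UnitaryGroup.cmDatum L 1 (Matrix.of fun i j : Fin 1 => if i.val + j.val + 1 = 1 then (1 : L) else 0)).toAdelic γH.2)) := by
  intro hK hanis Sbad Δ mH mG m' m mHi t' t tH hherm hCTM hACS μ hμu hμω mGs₀ hquot γ₀ e₁ e₂ hne hprod hnsc hchar γH hγH1 hγH2 v hsplit
  -- the frame data read by the deduction
  have hdet : H'.det ≠ 0 := det_ne_zero_of_anisotropic hanis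
  have hmHadm : (mH v).IsAdmissibleOn (IsLocalGRegular L v) := (hCTM.1 v).1.2.1
  have hmGadm : (mG v).IsAdmissibleOn (fun γ => IsRegularElt (γ.val : GL (Fin 3) (UnitaryGroup.LocalRing L v))) := (hCTM.1 v).1.2.2.1
  -- the singular point `(γ₀)_v` is killed by `(X − e₁)(X − e₂)`, `e₁ − e₂` a unit of `L ⊗ L⁺_v`
  have hab : IsUnit (algebraMap L (UnitaryGroup.LocalRing L v) e₁ - algebraMap L (UnitaryGroup.LocalRing L v) e₂) := isUnit_algebraMap_localRing_sub v hne
  have hγv := mul_sub_smul_toLocal_toAdelic_eq_zero v γ₀ hprod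
  have hnreg : ¬ IsRegularElt (γ₀.val : GL (Fin 3) L) := not_isRegularElt_of_charpoly_eq _ e₁ e₂ hchar
  -- members of `mGs₀ v` on the stable class of `(γ₀)_v` are finite on compacta
  have hfin : ∀ c : ConjClasses ((UnitaryGroup.cmDatum L 3 H').Local v),
      IsStablyConj (UnitaryGroup.conjLocal L (IsCMField.complexConj L) v) ((UnitaryGroup.adelicForm L 3 H').map (UnitaryGroup.adeleToLocal L v))
        ((UnitaryGroup.cmDatum L 3 H').toLocal v ((UnitaryGroup.cmDatum L 3 H').toAdelic γ₀)) (Quotient.out c) → IsFiniteMeasureOnCompacts ((mGs₀ v) c) := by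
    intro c hc
    exact ((hquot v).isAdmissibleOn c ⟨γ₀, hnreg, hc⟩).2.2
  -- kernel inclusion (#5U∣split = U2 ∘ U3) and the witness (#7U∣split = U1) at the split place `v`, for the explicit factor
  have hker := K2E3GermConstantStableSheetsUSplitOfDensity.GermConstantStableSheetsU_split_of_centralDensity L H' Tinf νH νG νGi νqi νHi hK hanis Sbad Δ mH mG m' m mHi t' t tH
    hherm hCTM hACS μ hμu hμω mGs₀ hquot γ₀ e₁ e₂ hne hprod hnsc hchar γH hγH1 hγH2 v hsplit
    (fun gH hg ht => K2E3CentralTransferVanishingSplitExplicit.centralTransferVanishing_split_explicit L H' Tinf νH νG νGi νqi νHi hK hanis Sbad Δ mH mG m' m mHi t' t tH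
      hherm hCTM hACS μ hμu hμω γH e₁ hγH1 v hsplit gH hg ht)
  obtain ⟨fH₀, f₀, hf₀, hfH₀, htr₀, hne₀⟩ := K2E3GermConstantRegularHUSplit.germConstantRegularHU_of_not_subsingleton L H' Tinf νH νG νGi νqi νHi hK hanis Sbad Δ mH mG
    m' m mHi t' t tH hherm hCTM hACS μ hμu hμω γ₀ e₁ e₂ hne hprod hnsc hchar γH hγH1 hγH2 v hsplit
  -- the linear algebra (§1), in the socket's curried shape
  refine Exists.imp (fun c hc => ⟨hc.1, fun fH f hf hfH htr => hc.2 fH f ⟨hf, hfH, htr⟩⟩)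
    (exists_ne_zero_forall_eq_mul_of_kernel_subset
    (fun (fH : (UnitaryGroup.cmDatum L 2 (Matrix.of fun i j : Fin 2 => if i.val + j.val + 1 = 2 then (1 : L) else 0)).Local v × (UnitaryGroup.cmDatum L 1 (Matrix.of fun i j : Fin 1 => if i.val + j.val + 1 = 1 then (1 : L) else 0)).Local v → ℂ) (f : (UnitaryGroup.cmDatum L 3 H').Local v → ℂ) =>
      IsLocSmooth f ∧ IsLocSmooth fH ∧ IsLocalDeltaTransfer L H' v (finExplicitCollection L H' μ (finExplicitDelta_conj_left_all L H' μ) (finExplicitDelta_conj_right_all L H' μ) v) (mH v) (mG v) fH f)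
    (fun f => localStableOrbitalIntegral L 3 H' v (mGs₀ v) f ((UnitaryGroup.cmDatum L 3 H').toLocal v ((UnitaryGroup.cmDatum L 3 H').toAdelic γ₀)))
    (fun fH => fH ((UnitaryGroup.cmDatum L 2 (Matrix.of fun i j : Fin 2 => if i.val + j.val + 1 = 2 then (1 : L) else 0)).toLocal v ((UnitaryGroup.cmDatum L 2 (Matrix.of fun i j : Fin 2 => if i.val + j.val + 1 = 2 then (1 : L) else 0)).toAdelic γH.1), (UnitaryGroup.cmDatum L 1 (Matrix.of fun i j : Fin 1 => if i.val + j.val + 1 = 1 then (1 : L) else 0)).toLocal v ((UnitaryGroup.cmDatum L 1 (Matrix.of fun i j : Fin 1 => if i.val + j.val + 1 = 1 then (1 : L) else 0)).toAdelic γH.2)))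
    ?_ ?_ ?_ ?_ ?_)
  · -- closure of the transfer pairs under `(p, q, a) ↦ p − a • q`
    rintro fH gH f g a ⟨hf, hfH, htr⟩ ⟨hg, hgH, htr'⟩
    refine ⟨isLocSmooth_sub_const_smul a hf hg, isLocSmooth_sub_const_smul a hfH hgH, ?_⟩
    have hsg := isLocSmooth_const_smul (-a) hg
    have hsgH := isLocSmooth_const_smul (-a) hgH
    have hadd := IsLocalDeltaTransfer.add L H' v hherm hdet hmHadm hmGadm hfH.continuous hfH.hasCompactSupport hsgH.continuous hsgH.hasCompactSupport
      hf.continuous hf.hasCompactSupport hsg.continuous hsg.hasCompactSupport htr (IsLocalDeltaTransfer.smul_fun L H' v htr' (-a))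
    rw [neg_smul, neg_smul, ← sub_eq_add_neg, ← sub_eq_add_neg] at hadd
    exact hadd
  · -- linearity of `Φ^st(γ_{0,v}, ·; mGs₀ v)` on `C_c`
    rintro fH gH f g a ⟨hf, -, -⟩ ⟨hg, -, -⟩
    have hsg := isLocSmooth_const_smul (-a) hg
    have hadd := localStableOrbitalIntegral_add_of_mul_sub_smul_eq_zero L 3 H' v hherm hdet _ hab hγv hfin hf.continuous hf.hasCompactSupport
      hsg.continuous hsg.hasCompactSupport
    have hsmul : localStableOrbitalIntegral L 3 H' v (mGs₀ v) ((-a) • g) ((UnitaryGroup.cmDatum L 3 H').toLocal v ((UnitaryGroup.cmDatum L 3 H').toAdelic γ₀)) =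
        (-a) * localStableOrbitalIntegral L 3 H' v (mGs₀ v) g ((UnitaryGroup.cmDatum L 3 H').toLocal v ((UnitaryGroup.cmDatum L 3 H').toAdelic γ₀)) :=
      stableOrbitalIntegralRel_smul_fun _ (mGs₀ v) (-a) g _
    show localStableOrbitalIntegral L 3 H' v (mGs₀ v) (f - a • g) _ = localStableOrbitalIntegral L 3 H' v (mGs₀ v) f _ - a * localStableOrbitalIntegral L 3 H' v (mGs₀ v) g _
    rw [sub_eq_add_neg, ← neg_smul, hadd, hsmul, neg_mul, ← sub_eq_add_neg]
  · -- evaluation is linear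
    intro fH gH a
    simp only [Pi.sub_apply, Pi.smul_apply, smul_eq_mul]
  · rintro fH f ⟨hf, hfH, htr⟩ h0
    exact hker fH f hf hfH htr h0
  · exact ⟨fH₀, f₀, ⟨hf₀, hfH₀, htr₀⟩, hne₀⟩

end Frame

end Summit.HodgeConjecture.HodgeConjecture.Cruxes.H413.K2E4ExplicitSplitSingularTransferU

end
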